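import Literature.NumberTheory.EllipticCurves.DeligneSerreProp27WeightOneDescentProofs
import Literature.NumberTheory.EllipticCurves.ManinSymbolsWeightKGamma1RankProofs
import Literature.NumberTheory.EllipticCurves.ModularFormsGamma1Dimension
import HarnessLib

/-!
# Deligne–Serre 1974, Prop. 2.7 (2.7.3) (`prop27_eigenvalues`): the last reduction — to the
# Manin-symbol count with cusps for `Γ₁(M)`, `8 ∣ M`, in the single weight `8`

A proofs-only leaf (theorems only; no definition, no named fact, nothing restated; D-0026) of the
discharge of the named fact
`Literature.NumberTheory.EllipticCurves.ModularForms.DeligneSerre1974.prop27_eigenvalues`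
(`DeligneSerreRankinProofs`; Deligne–Serre, *Formes modulaires de poids 1*, Prop. 2.7 (2.7.3),
p. 512: the eigenvalues of the `T_p`, `p ∤ N`, on a non-zero eigenform of type `(k, ε)` are
integers of a finite extension of `ℚ`, every weight `k ≥ 1`).

State of the tree.  Weights `k ≥ 2` are unconditional (`DeligneSerreProp27HigherWeightProofs`);
weight one was reduced (`DeligneSerreProp27WeightOneDescentProofs`: the `θ²`, `θ(2τ)²` descent at
levels `8 ∣ M` and the `U₂` trick, then division by `E₄`, `E₆`) to the spanning statement (2.7.2) in
**one** weight `K₀ ≥ 2` at the levels `8 ∣ M`, and through Shimura's (3.5.20)/Thm. 3.52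
(`DeligneSerreProp27RealLatticeProofs`, `EichlerShimuraPeriodsGamma1RealSpanProofs`) to the rank
half of the Eichler–Shimura isomorphism there:
`prop27_eigenvalues_of_forall_periodLatticeK1_eq_span_of_five_le n (hn : 5 ≤ n)` asks that the
period lattice `Λ_n = periodLatticeK1 n ⊆ S_{n+2}(Γ₁(M))^∨` be the `ℤ`-span of
`2 dim_ℂ S_{n+2}(Γ₁(M))` functionals for every `8 ∣ M`.  Two inputs for that count are now in the
tree:

* the **dimension (existence) half** for `Γ₁(M)`, `M ≥ 4`, every even weight, by the free-module
  route (`ModularFormsGamma1Dimension.le_twelve_mul_finrank_cuspForm_gamma1`: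
  `(k - 1)[SL₂(ℤ) : ±Γ₁(M)] - 6 ε_∞ ≤ 12 dim S_k(Γ₁(M))` with `ε_∞ = #Level.basePoints (±Γ₁(M))`,
  the number of `⟨T⟩`-orbits on `SL₂(ℤ)/±Γ₁(M)`; Diamond–Shurman Thm. 3.5.1);
* the **Manin-symbol machinery** in weight `n + 2` (`ManinSymbolsWeightK`,
  `ManinSymbolsWeightKGamma1Periods`: `Λ_n` is finitely generated with finite-dimensional `ℚ`-span,
  `12 dim_ℚ ℚΛ_n ≤ (n + 1)[SL₂(ℤ) : Γ₁(M)]`, and the generator form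
  `exists_coe_eq_span_range_of_finrank_span_le`).

This file first isolates the one remaining inequality in the exact currency of those files — the
Manin-symbol count *with the cusps subtracted* (Merel 1994, §1.4 Prop. 5–6; Shimura 1971, (8.2.23)):

  `12 (dim_ℚ ℚΛ_n + ε_∞) ≤ (n + 1) [SL₂(ℤ) : Γ₁(M)]`,  `ε_∞ = #Level.basePoints (±Γ₁(M))`,   (∗)

and proves:

* `finrank_span_periodLatticeK1_le_two_mul_finrank` — (∗) and the dimension half give
  `dim_ℚ ℚΛ_n ≤ 2 dim_ℂ S_{n+2}(Γ₁(M))` (`M ≥ 4`, `n` even), since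
  `[SL₂(ℤ) : Γ₁(M)] = 2[SL₂(ℤ) : ±Γ₁(M)]` (`two_mul_index_gamma1pm_eq`);
* `periodLatticeK1_eq_span_of_rank_add_card_le` — hence `Λ_n` is the `ℤ`-span of
  `2 dim_ℂ S_{n+2}(Γ₁(M))` functionals (the hypothesis shape of
  `heckeStableRealLatticeOfGenerators`, `prop55_of_periodLatticeK1_eq_span`,
  `span_integralLattice1_of_periodLatticeK1_eq_span`);
* **`prop27_eigenvalues_of_rank_add_card_le`** — Deligne–Serre (2.7.3) in every weight, weight one
  included, from (∗) at the levels `8 ∣ M` in the single weight `n + 2 = 8`.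

And (∗) is now a theorem: `ManinSymbolsWeightKGamma1RankProofs` proves
`ManinK.twelve_mul_finrank_add_card_le` — `12 (dim_ℚ ℚΛ_n + dim_ℚ ⟨orbit indicators⟩) ≤
(n + 1)[SL₂(ℤ) : Γ₁(M)]` for `M ≥ 4`, `n ≥ 2` even and any `Γ₁(M) ≤ Γ' ∋ -1` (Manin's chains, the
boundary symbol, and a Manin–Drinfeld step for the cusps above `∞` with `T_p - (1 + p^{n+1})`,
`p ≡ 1 (mod M)`), the orbit count entering as the dimension of the span of the `⟨T⟩`-orbit
indicators `ManinK.tind Γ'` on `SL₂(ℤ)/Γ'`.  We identify that dimension with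
`#Level.basePoints Γ'` (`ManinK.finrank_span_range_tind`: the indicators of the distinct orbits —
one per base point — are linearly independent, and every indicator is that of a base point), take
`Γ' = ±Γ₁(M)`, and conclude:

* **`DeligneSerre1974.prop27_eigenvalues_holds : prop27_eigenvalues`** — the discharge of
  Deligne–Serre 1974, Prop. 2.7 (2.7.3), in every weight `k ≥ 1` and at every level.

## References

* P. Deligne, J.-P. Serre, *Formes modulaires de poids 1*, Ann. Sci. ÉNS (4) 7 (1974), 507–530:
  Prop. 2.7 and Rem. 2.8 (p. 512). [DeligneSerreASENS1974]
* G. Shimura, *Introduction to the arithmetic theory of automorphic functions*, Publ. Math. Soc.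
  Japan 11 (1971): (3.5.20), Thm. 3.52, Thm. 8.4 and (8.2.23). [ShimuraIATAF1971]
* L. Merel, *Universal Fourier expansions of modular forms*, in: On Artin's conjecture for odd
  2-dimensional representations, LNM 1585 (1994), §1.2–1.4. [Merel1994]
* F. Diamond, J. Shurman, *A first course in modular forms*, GTM 228 (2005), Thm. 3.5.1, Fig. 3.4.
  [DiamondShurman2005]
-/

noncomputable section

open scoped MatrixGroups ModularForm

open CongruenceSubgroup Module

namespace Literature.NumberTheory.EllipticCurves.ModularForms

section RankCount

variable (M : ℕ) [NeZero M] (n : ℕ)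

/-- **`dim_ℚ ℚΛ_n ≤ 2 dim_ℂ S_{n+2}(Γ₁(M))`** for `M ≥ 4` and even `n`, from the Manin-symbol count
with cusps `12 (dim_ℚ ℚΛ_n + ε_∞) ≤ (n + 1)[SL₂(ℤ) : Γ₁(M)]` and the dimension half
`(n + 1)[SL₂(ℤ) : ±Γ₁(M)] - 6 ε_∞ ≤ 12 dim S_{n+2}(Γ₁(M))` (`le_twelve_mul_finrank_cuspForm_gamma1`),
using `[SL₂(ℤ) : Γ₁(M)] = 2 [SL₂(ℤ) : ±Γ₁(M)]`. [cite: ShimuraIATAF1971, Thm. 8.4 and (8.2.23)] -/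
theorem finrank_span_periodLatticeK1_le_two_mul_finrank (hM : 4 ≤ M) (hn : Even n)
    (h : 12 * (finrank ℚ (Submodule.span ℚ (periodLatticeK1 (N := M) n :
        Set (Module.Dual ℂ (CuspForm (Gamma1 M) (n + 2))))) +
          (Level.basePoints (Gamma1pm M)).card) ≤ (n + 1) * (Gamma1 M).index) :
    finrank ℚ (Submodule.span ℚ (periodLatticeK1 (N := M) n :
        Set (Module.Dual ℂ (CuspForm (Gamma1 M) (n + 2))))) ≤
      2 * finrank ℂ (CuspForm (Gamma1 M) (n + 2)) := by
  have hidx : 2 * (Gamma1pm M).index = (Gamma1 M).index := two_mul_index_gamma1pm_eq M (by omega)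
  have hk : Even ((n : ℤ) + 2) := by
    obtain ⟨m, hm⟩ := hn
    exact ⟨(m : ℤ) + 1, by omega⟩
  have hdim := le_twelve_mul_finrank_cuspForm_gamma1 M hM (k := (n : ℤ) + 2) hk
  -- everything over `ℤ`
  have h' : 12 * ((finrank ℚ (Submodule.span ℚ (periodLatticeK1 (N := M) n :
        Set (Module.Dual ℂ (CuspForm (Gamma1 M) (n + 2))))) : ℤ) +
          ((Level.basePoints (Gamma1pm M)).card : ℤ)) ≤ ((n : ℤ) + 1) * (2 * (Gamma1pm M).index) := by
    have := h
    rw [← hidx] at this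
    exact_mod_cast this
  have hdim' : ((n : ℤ) + 2 - 1) * ((Gamma1pm M).index : ℤ) -
      6 * ((Level.basePoints (Gamma1pm M)).card : ℤ) ≤
        12 * (finrank ℂ (CuspForm (Gamma1 M) ((n : ℤ) + 2)) : ℤ) := hdim
  have : (finrank ℚ (Submodule.span ℚ (periodLatticeK1 (N := M) n :
        Set (Module.Dual ℂ (CuspForm (Gamma1 M) (n + 2))))) : ℤ) ≤
      2 * (finrank ℂ (CuspForm (Gamma1 M) ((n : ℤ) + 2)) : ℤ) := by
    nlinarith [h', hdim', (Nat.cast_nonneg (α := ℤ) (Gamma1pm M).index)]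
  exact_mod_cast this

/-- **The generator form of the rank half of Eichler–Shimura for `Γ₁(M)` in weight `n + 2`** (the
hypothesis shape of `heckeStableRealLatticeOfGenerators` and `prop55_of_periodLatticeK1_eq_span`):
granted the Manin-symbol count with cusps, the period lattice `periodLatticeK1 n` of
`S_{n+2}(Γ₁(M))` (`M ≥ 4`, `n` even) is the `ℤ`-span of `2 dim_ℂ S_{n+2}(Γ₁(M))` functionals — it is
finitely generated and torsion-free, and `dim_ℚ ℚΛ_n ≤ 2 dim_ℂ S_{n+2}`
(`exists_coe_eq_span_range_of_finrank_span_le`).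
[cite: ShimuraIATAF1971, Thm. 8.4 with Prop. 8.6 and (8.2.23)] -/
theorem periodLatticeK1_eq_span_of_rank_add_card_le (hM : 4 ≤ M) (hn : Even n)
    (h : 12 * (finrank ℚ (Submodule.span ℚ (periodLatticeK1 (N := M) n :
        Set (Module.Dual ℂ (CuspForm (Gamma1 M) (n + 2))))) +
          (Level.basePoints (Gamma1pm M)).card) ≤ (n + 1) * (Gamma1 M).index) :
    ∃ g : Fin (2 * finrank ℂ (CuspForm (Gamma1 M) (n + 2))) →
        Module.Dual ℂ (CuspForm (Gamma1 M) (n + 2)),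
      (periodLatticeK1 (N := M) n : Set (Module.Dual ℂ (CuspForm (Gamma1 M) (n + 2)))) =
        Submodule.span ℤ (Set.range g) :=
  exists_coe_eq_span_range_of_finrank_span_le (periodLatticeK1 n) (periodLatticeK1_fg M n)
    (finrank_span_periodLatticeK1_le_two_mul_finrank M n hM hn h)

end RankCount

/-- **Deligne–Serre 1974, Prop. 2.7 (2.7.3), every weight (weight one included), from the
Manin-symbol count with cusps at the levels `8 ∣ M` in weight `8`.**  If for every level `M`
divisible by `8` the period lattice `Λ₆ ⊆ S₈(Γ₁(M))^∨` and the `⟨T⟩`-orbit count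
`ε_∞ = #Level.basePoints (±Γ₁(M))` satisfy `12 (dim_ℚ ℚΛ₆ + ε_∞) ≤ 7 [SL₂(ℤ) : Γ₁(M)]` (Merel 1994,
§1.4; Shimura (8.2.23) with the Manin–Drinfeld step for the cusps above `∞`), then the eigenvalues of
the `T_p`, `p ∤ N`, on every non-zero eigenform of type `(k, ε)` on `Γ₀(N)`, `k ≥ 1`, are integers of
a finite extension of `ℚ`: `periodLatticeK1_eq_span_of_rank_add_card_le` (`M ≥ 8 ≥ 4`, `n = 6`) feeds
`prop27_eigenvalues_of_forall_periodLatticeK1_eq_span_of_five_le` (real spanning in weight `8`,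
Shimura Thm. 3.52, descent to weight one at the levels `8 ∣ M`).
[cite: DeligneSerreASENS1974, Prop. 2.7 (2.7.3) and Rem. 2.8] -/
theorem prop27_eigenvalues_of_rank_add_card_le
    (H : ∀ (M : ℕ) [NeZero M], 8 ∣ M →
      12 * (finrank ℚ (Submodule.span ℚ (periodLatticeK1 (N := M) 6 :
          Set (Module.Dual ℂ (CuspForm (Gamma1 M) (6 + 2))))) +
            (Level.basePoints (Gamma1pm M)).card) ≤ (6 + 1) * (Gamma1 M).index) :
    DeligneSerre1974.prop27_eigenvalues :=
  prop27_eigenvalues_of_forall_periodLatticeK1_eq_span_of_five_le 6 (by norm_num) fun M _ h8 ↦ by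
    have hM : 4 ≤ M := by
      have := Nat.le_of_dvd (Nat.pos_of_ne_zero (NeZero.ne M)) h8
      omega
    exact periodLatticeK1_eq_span_of_rank_add_card_le M 6 hM (by decide) (H M h8)

/-! ### The orbit indicators span a space of dimension `#basePoints`, and the discharge -/

section OrbitCount

variable (Γ' : Subgroup SL(2, ℤ)) [Γ'.FiniteIndex]

/-- The orbit indicator of a coset is that of its base point (`base y = T^{-off y} y`). [folklore] -/
theorem ManinK.tind_base (y : ManinK.Coset Γ') :
    ManinK.tind Γ' (Level.base Γ' y) = ManinK.tind Γ' y := by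
  rw [← Level.T_zpow_neg_off_smul y, ManinK.tind_T_zpow_smul]

/-- The orbit indicator of a base point vanishes at every other base point (distinct base points lie
in distinct `⟨T⟩`-orbits). [folklore] -/
theorem ManinK.tind_apply_eq_zero_of_base {b b' : ManinK.Coset Γ'} (hb : Level.base Γ' b = b)
    (hb' : Level.base Γ' b' = b') (hne : b ≠ b') : ManinK.tind Γ' b b' = 0 := by
  classical
  simp only [ManinK.tind]
  rw [if_neg]
  rintro ⟨m, hm⟩
  apply hne
  have h := Level.base_T_zpow_smul b m
  rw [hm, hb', hb] at h
  exact h.symm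

/-- **`dim_ℚ ⟨orbit indicators⟩ = #basePoints`**: the span of the `⟨T⟩`-orbit indicators
`ManinK.tind Γ'` on `SL₂(ℤ)/Γ'` has dimension the number of `⟨T⟩`-orbits, counted as
`#Level.basePoints Γ'` (one base point per orbit, `Level.basePointsEquiv`): every indicator is that
of a base point, and the indicators of the base points are linearly independent (evaluate at a base
point). [folklore] -/
theorem ManinK.finrank_span_range_tind :
    finrank ℚ (Submodule.span ℚ (Set.range (ManinK.tind Γ'))) = (Level.basePoints Γ').card := by
  classical
  set e : {x // x ∈ Level.basePoints Γ'} → (ManinK.Coset Γ' → ℚ) := fun b ↦ ManinK.tind Γ' b.1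
    with he
  have hmem : ∀ b : {x // x ∈ Level.basePoints Γ'}, Level.base Γ' b.1 = b.1 := fun b ↦
    (Finset.mem_filter.mp b.2).2
  have hrange : Set.range (ManinK.tind Γ') = Set.range e := by
    ext f
    constructor
    · rintro ⟨y, rfl⟩
      exact ⟨⟨Level.base Γ' y, Level.base_mem_basePoints y⟩, ManinK.tind_base Γ' y⟩
    · rintro ⟨b, rfl⟩
      exact ⟨b.1, rfl⟩
  have hli : LinearIndependent ℚ e := by
    rw [Fintype.linearIndependent_iff]
    intro g hg i
    have h := congr_fun hg i.1
    simp only [Finset.sum_apply, Pi.smul_apply, smul_eq_mul, Pi.zero_apply] at h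
    rw [Finset.sum_eq_single i] at h
    · simpa [he, ManinK.tind_apply_self] using h
    · intro b _ hbi
      simp only [he]
      rw [ManinK.tind_apply_eq_zero_of_base Γ' (hmem b) (hmem i)
        (fun hh ↦ hbi (Subtype.ext hh)), mul_zero]
    · intro hi
      exact absurd (Finset.mem_univ i) hi
  rw [hrange, finrank_span_eq_card hli, Fintype.card_coe]

end OrbitCount

/-- **Deligne–Serre 1974, Prop. 2.7 (2.7.3)** — the discharge of the named fact
`DeligneSerre1974.prop27_eigenvalues` (`DeligneSerreRankinProofs`): for every level `N ≥ 1`, every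
weight `k`, every Dirichlet character `ε` mod `N` and every non-zero cusp form `f` of type `(k, ε)`
on `Γ₀(N)` which is an eigenfunction of the `T_p`, `p ∤ N`, the eigenvalues `a_p` are algebraic
integers lying in one finite extension of `ℚ` ("Les valeurs propres des `T_p` dans `S_ℂ` sont des
entiers d'une extension finie de `ℚ`", op. cit. p. 512).  Proof in the tree: weights `k ≥ 2` by the
Eichler–Shimura period lattice (`DeligneSerreProp27HigherWeightProofs`); weight one by the printed
route through (2.7.1)–(2.7.2) (a Hecke-stable lattice of finite type spanning `S_1`), where (2.7.2)
in weight one at level `8N'` is obtained from (2.7.2) in weight `8` at that level by the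
`θ²`/`θ(2τ)²` descent and division by `E₄`, `E₆` (Deligne–Serre Rem. 2.8;
`DeligneSerreProp27WeightOneDescentProofs`), (2.7.2) in weight `8` from a full Hecke-stable real
lattice (Shimura 1971, (3.5.20), Thm. 3.52; `DeligneSerreProp27RealLatticeProofs`), and that lattice
is the period lattice `Λ₆` by the real spanning (`EichlerShimuraPeriodsGamma1RealSpanProofs`) and
the rank count `rank Λ₆ ≤ 2 dim S₈(Γ₁(M))` = Manin symbols with cusps
(`ManinK.twelve_mul_finrank_add_card_le`, `ManinSymbolsWeightKGamma1RankProofs`) + the dimension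
formula lower bound (`le_twelve_mul_finrank_cuspForm_gamma1`, `ModularFormsGamma1Dimension`).
[cite: DeligneSerreASENS1974, Prop. 2.7 (2.7.1)–(2.7.3) and Rem. 2.8] -/
theorem DeligneSerre1974.prop27_eigenvalues_holds : DeligneSerre1974.prop27_eigenvalues :=
  prop27_eigenvalues_of_rank_add_card_le fun M _ h8 ↦ by
    have hM : 4 ≤ M := by
      have := Nat.le_of_dvd (Nat.pos_of_ne_zero (NeZero.ne M)) h8
      omega
    have h := ManinK.twelve_mul_finrank_add_card_le M (gamma1_le_gamma1pm M) (by decide : Even 6)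
      (by norm_num) (neg_one_mem_gamma1pm M) hM
    rwa [ManinK.finrank_span_range_tind] at h

end Literature.NumberTheory.EllipticCurves.ModularForms
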